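import Summits.QuantumFields.YangMills.Theorems.BalabanUVNodesN22AtRecordOfTermDataTableGermsLocatedRadiiMembersOfLemma2Records
import Summits.QuantumFields.YangMills.Theorems.BalabanUVNodesN22W1LocatedRecordsWitnessHalfRate
import Summits.QuantumFields.YangMills.Theorems.BalabanUVNodesN18HLayerW1NumeralsStrict

/-!
# BalabanUVNodes ∕ node N22 = NE9 — MODULE J90: THE POSITIVE A2 CERTIFICATE OF THE ROAD-2 SOCKET OF RECORD J89 — EVERY BINDER OF
# `n22At_u3OfRecord₁₃_of_kernelStepRate_termDataTableGermsLocatedRadiiMembersOfLemma2RecordsNonexpansive` THAT IS NOT AN OWNER's RECORD ∕ LAW ∕ CHART DATUM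
# (the 45 numeric rows incl. `Lemma3Numerics`, the unscaled-field law, the box laws, `χᵘχᶜᵘ ≤ 1`, `𝒲`'s measurability, the coupling sets `D`, the located family `hιc`)
# IS JOINTLY INHABITED — at ONE constants record (`B13Lemma3TorusNonvacuity.consts`), ONE letter set, ONE degenerate datum (module J88-W′)

Cell `pub-ymgap`, HUMAN RULING D-0062 (Track A), R134 seat `pub-ymgap-dag-n22-c` (strategy s1), generation 23, module J90.  THEOREMS ONLY (no `def`, no `sorry`, standard axioms);
`--kind proof --supports stmt-QuantumFields-27366 --as helper` (K3⁸), COUNT-NEUTRAL.  Imports the socket J89 (for its vocabulary; it is NOT applied), this lane's J88-W′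
`…N22W1LocatedRecordsWitnessHalfRate` (datum side at `a₅ = ½`, `ρ_b = 1∕100`) and dag-n18-c's `…N18HLayerW1NumeralsStrict` (public facts about the witness record `consts`:
`eps2_consts_eq`, `alpha6w_lt_one`, `strictKP_of_le_one_of_lt`; through it this lane's g7 `…N22W1StripNumeralsAnyM.lemma3Numerics_consts_anyM` and
`B13Lemma3TorusNonvacuity.numerics_nonvacuous_pos_consts ∕ consts_L`).  Nothing re-declared.

WHY.  Director-ym №274 (2026-08-29) booked this lane's A2 self-audit J91-V (the located ROAD-1 sockets are VACUOUS: weight floor vs age-decay) and made J89 THE N22 socket of record,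
with the standing reminder (v): a socket displaying two bound families on the same letters carries an A2 JOINT-INHABITATION line.  J89 displays, next to the OWNERS' records and
laws, ≈ 45 pure-numeric rows in shared letters (`Lemma3Numerics c M 4 a a₂ a₂′ a₅ Aabs`, the capstone rows `hrate hKP hsmall2 hrenew(E) hC1 hR hBqv …`, W1-8's apertures, the
`ℓ`-rows `hκ₅ hω hθω hℓκ hC₉`) and the four datum-side binder types `hlaw hBox hχ1 hιc` whose located records are `Inputs226Holo c … a a₅` — the SAME `c, a, a₅` as the numerics.
g22's desk memo `N22-A2-NUMERICS-DESKCHECK-g22.md` inspected the numeric rows; J88-Wb inhabited the datum side at `a₅ = 2`; but at the numerics record of record `consts` the row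
hC3 forces `Aabs ≤ 2 − e^{−a∕20}` against `habs : a₅ + e^{−(κ₁−1)∕2} ≤ Aabs` — `a₅ = 2` does NOT fit `consts`.  THIS FILE puts both sides at ONE `(c, a, a₅) = (consts, aw + 40M, ½)`:
★ `socketNonOwnerBinders_inhabited` — for EVERY parameter tower `F`, cube count `M`, block size `L` (J89 admits only `L = consts.L = 8` through `hLc`; §2 states that conjunct as `consts.L = 8`, §3 (v1.1) takes `hLc : consts.L = L` verbatim), table system `sp`, window `γ`, NODE-N18 letters `θ₅ ∈ ]0,1[`, `κ₅ > 0` and `C₅`, chart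
letters `B₃, r`, EVERY renewal size `E₀ ≥ e·9·64·K₀(64,8)²·C₃ε₁` and EVERY history decay rate `r₁ ∈ [2κ₀(64,8) + 1, consts.κ − 1]` (the interval is nonempty: §0), there EXIST the
bill's letter record `ℓ` (with `ℓ.θ₅ = θ₅`, `ℓ.Signs`), the lane-side reals `a κ κE δ₀ R ϱ Mb cw cS cA Mv Bq b`, weights `aw`, coupling sets `D`, a term-data family `𝔇` over `consts`
and readings `χᵘ χᶜᵘ 𝒲 𝒪` such that EVERY ONE of J89's binders `hL hLc hκ₁ hα₆ hN hκ₀ hδ₀ hκE hκE0 hE₀ hA0 hr₁ hrate hKP hκr hrenew hrenewE hawcw hC1 hMb0 hϱ hR hcS hcSA hcA1 hρb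
hBq hsmall2 hMv hBqv hρb1 hb hbaw hκ₅ hω hθω hℓκ hC₉ hD hlaw hBox hχ1 hWm hιc` holds AT ONCE (`ρ_b = 1∕100`, `a₅ = ½`, `a₂ = a₂′ = Aabs = 1`, `θ.γ ↦ γ`; the bodies are J89's
VERBATIM with these literals).  Values: `a := aw + 40M` (`lemma3Numerics_consts_anyM`), `κ := κE := 2κ₀ + 1`, `δ₀ := min 1 κ₅`, `Mb := e·9·64·K₀²·C₃ε₁`, `ϱ := 1`,
`cw := b := aw ≡ 1∕(8Mb + 8)`, `R := cw·E₀ + 2`, `cS := 1∕400 < cA := 1∕200`, `Mv := 2`, `Bq :=` hBqv's left side, `ℓ := ⟨κ := delta1 δ₀ κ 4M, θ₅, C₅ := 0, C₉ := max 0 (hC₉'s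
left side), ω := ρ := (1+θ₅)∕2, cr := 0⟩`, `D K := univ`; hKP by dag-n18-c's `strictKP_of_le_one_of_lt` (`r₁ < consts.κ`), hsmall2 by the slack `e^{−5} ≤ ½` at `r₁ ≤ consts.κ − 1`;
W1-8's elementary conditions of J88-W′ at `consts` (`hpref`: `E₀ε₁C₁α₄⁻¹M^q e^{C₂κ₁} = ε₂·α₆∕2 ≤ ½` from R15 and `α₆ < 1`).
WHAT IS LEFT DISPLAYED IN J89 AFTER THIS FILE (the OWNERS', by name): (1.21) `hlim`, N18's rate `h5` (letters `κ₅ θ₅ C₅` — universal here), W1-20's law `hloc`, NODE A's located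
records `hι` (N10-107 shape) and `hloc18` (N18 shape) AT THE DATUM OF RECORD, the reading laws `hread hmaps hW hcont hjc hK hμ` (def-W1's atoms), the table plumbing `hsp hbigo hrestr
hbig` (inhabited by `big := sp` given `hsp`; `SpRestr` is the tables' own), the chart block `ι Φ U hU hrU hΦhol hΦemb hΦsp w hw₀ hw htail`, and the signs `hγ hC₅ hB₃ hr hCk hmk hM`
of the owners' letters.  Universal here and SHARED with owners: `θ₅ κ₅` (N18), `δ₀` is CHOSEN (≤ κ₅; the chart tail `htail` is monotone in `δ₀`), `E₀, r₁` (the admissible class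
`AdmHist sp E₀ r₁` of `hι ∕ hloc18 ∕ hιc`) range over the whole interval the numerics allow.
* §0 `r₁Interval_nonempty`, `renewalSize_nonneg` — the universal ranges are inhabited.  * §1 `pref_consts` — W1-8's `hpref` at `consts`.  * §2 ★ `socketNonOwnerBinders_inhabited`.
* §3 (v1.1, ref-F READ-795 NIT-1) ★ `socketNonOwnerBinders_inhabited_atBlockSize` — the same with J89's `hLc : c.L = L` VERBATIM (hypothesis `consts.L = L`, i.e. `L = 8`).

HONEST FRAMING (binding).  An A2 JOINT-INHABITATION certificate (director-ym №274 (v)) at DEGENERATE data (J88-W′: free kernels, zero potentials, indicator boxes — NOT Bałaban's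
objects) and at the witness constants `consts` (formal consistency of the typed inequalities, not realism: `K₀ ≈ e^{321}`, `ε₁ ≈ e^{−O(10⁴)}`); it says the non-owner antecedent
of J89 is not empty and fits ONE `(c, a, a₅)`; it does NOT inhabit the owners' hypotheses and claims NO joint inhabitant of J89's whole antecedent.  Nothing of Bałaban's asserted;
N22 NOT discharged; K3⁸ OPEN; counts UNMOVED; one finite 𝕋⁴ programme at fixed ε — NOTHING about the continuum, ℝ⁴, infinite volume, OS, a mass gap or Clay.
References (TYPES only): [II] = Bałaban, CMP 116 (1988) (2.16)–(2.22) p. 16, (2.23)–(2.26) p. 17, Lemma 3 (2.38) p. 20, (2.39)–(2.41) p. 21 and the closing paragraph p. 21 («The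
assumptions allow finally us to fix all the constants»); [I] = CMP 109 (1987) §1 p. 263, (1.20)–(1.22) p. 264; Kotecký–Preiss, CMP 103 (1986) p. 492.
-/

noncomputable section

open Set Metric
open scoped BigOperators Matrix

namespace YMDAG.N22.KernelFading

open Literature.MathematicalPhysics.QuantumFieldTheory.Balaban1983to89
open Literature.MathematicalPhysics.QuantumFieldTheory.Balaban1983to89.T4Continuum (T4Family)
open Literature.MathematicalPhysics.QuantumFieldTheory.Balaban1983to89.TreeLengthTorus (TPt TDom tsys)
open Literature.MathematicalPhysics.QuantumFieldTheory.Balaban1983to89.B9Thm37GlueTorus (tdist1)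
open Literature.MathematicalPhysics.QuantumFieldTheory.Balaban1983to89.B12TreeDecay (K₀ kappa₀ K₀_pos kappa₀_nonneg)
open Literature.MathematicalPhysics.QuantumFieldTheory.Balaban1983to89.B12Decay510 (delta1 delta1_le_half delta1_nonneg)
open Literature.MathematicalPhysics.QuantumFieldTheory.Balaban1983to89.B12Decay510Window (K₁)
open Literature.MathematicalPhysics.QuantumFieldTheory.Balaban1983to89.B13Lemma3TorusTerms (terms)
open Literature.MathematicalPhysics.QuantumFieldTheory.Balaban1983to89.B13Lemma3TorusSocket (Lemma3Numerics)
open Literature.MathematicalPhysics.QuantumFieldTheory.Balaban1983to89.B13Lemma3WindowNonvacuity (κ₀w κw α₆w ε₂w)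
open Literature.MathematicalPhysics.QuantumFieldTheory.Balaban1983to89.B13Lemma3TorusNonvacuity (κ₁t consts numerics_nonvacuous_pos_consts consts_L)
open Literature.MathematicalPhysics.QuantumFieldTheory.Balaban1983to89.Node00 (U3Letters₁₁)
open Literature.MathematicalPhysics.QuantumFieldTheory.Balaban1983to89.Node00.Sect2 (domSys domCount CPair)
open Literature.MathematicalPhysics.QuantumFieldTheory.Balaban1983to89.Node00.W1
open Summit.QuantumFields.YangMills.BalabanUVNodes.N18HLayerW1NumeralsStrict (eps2_consts_eq alpha6w_lt_one witness_signs strictKP_of_le_one_of_lt)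
open YMDAG.N22.W1 (lemma3Numerics_consts_anyM socketFamilies_inhabited_lemma2_half)

/-! ## §0 The universal ranges are inhabited -/

/-- **THE ADMISSIBLE DECAY-RATE INTERVAL IS NONEMPTY**: `2κ₀(64,8) + 1 ≤ consts.κ − 1` (`consts.κ = 20(κ₀ + 64)`).  So the universal `r₁` of §2 exists.
[cite: Balaban1988RG2Cluster, p.21 (closing paragraph; bookkeeping at the witness)] -/
theorem r₁Interval_nonempty : 2 * kappa₀ (4 * 2 ^ 4) (2 * 4) + 1 ≤ consts.κ - 1 := by
  have e : kappa₀ (4 * 2 ^ 4) (2 * 4) = kappa₀ 64 8 := by norm_num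
  have h0 : 0 ≤ kappa₀ 64 8 := kappa₀_nonneg (by norm_num) 8
  show 2 * kappa₀ (4 * 2 ^ 4) (2 * 4) + 1 ≤ 20 * (kappa₀ 64 8 + 64) - 1
  rw [e]; linarith

/-- **THE RENEWAL SIZE IS A NONNEGATIVE REAL**: `0 ≤ e·9·64·K₀(64,8)²·C₃ε₁` at `consts`.  So the universal `E₀` of §2 exists (any real above it).
[cite: Balaban1988RG2Cluster, (2.41) p.21 (bookkeeping at the witness)] -/
theorem renewalSize_nonneg : 0 ≤ Real.exp 1 * 9 * 64 * K₀ 64 8 ^ 2 * (consts.C3act * consts.ε₁) :=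
  mul_nonneg (by positivity) numerics_nonvacuous_pos_consts.2.2.2.2.2.2.2.2.2.2.2.2.2.2.2.2.2.2.2.2.2.2.2.2.2.2.2.2.1

/-! ## §1 W1-8's elementary smallness at the witness record -/

/-- **W1-8's `hpref` AT `consts`**: `E₀·ε₁·C₁·α₄⁻¹·M^q·e^{C₂κ₁} ≤ ½` — at the witness this product is `ε₂·α₆∕2` (`E₀ = 2`, `C₁ = α₄ = C₂ = 1`, `q = 0`, `ε₁ = ε₂α₆e^{−κ₁}∕4`), and
`ε₂ ≤ 1` (R15 `ε₂e^{5κ} ≤ 1`), `α₆ < 1`. [cite: Balaban1988RG2Cluster, p.19 (the product defining ε₂) and p.21 (closing paragraph)] -/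
theorem pref_consts : consts.E₀ * consts.ε₁ * consts.C₁ * consts.α₄⁻¹ * consts.M ^ consts.q * Real.exp (consts.C₂ * consts.κ₁) ≤ 1 / 2 := by
  obtain ⟨-, -, -, -, h5, -, -, h8, -, h10, -⟩ := numerics_nonvacuous_pos_consts
  have hε₂0 : 0 ≤ ε₂w := by rw [← eps2_consts_eq]; exact h5
  have hε₂1 : ε₂w ≤ 1 := by
    rw [← eps2_consts_eq]
    have h1 : 1 ≤ Real.exp (5 * consts.κ) := Real.one_le_exp (by linarith)
    have h2 : consts.eps2 * Real.exp (5 * consts.κ) ≤ 1 := h10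
    nlinarith
  have hα0 : 0 ≤ α₆w := witness_signs.2.1.le
  have hα1 : α₆w ≤ 1 := alpha6w_lt_one.le
  have hexp : Real.exp (-κ₁t) * Real.exp (1 * κ₁t) = 1 := by rw [one_mul, ← Real.exp_add, neg_add_cancel, Real.exp_zero]
  show 2 * (ε₂w * α₆w * Real.exp (-κ₁t) / 4) * 1 * (1 : ℝ)⁻¹ * (κw + 1) ^ 0 * Real.exp (1 * κ₁t) ≤ 1 / 2
  calc 2 * (ε₂w * α₆w * Real.exp (-κ₁t) / 4) * 1 * (1 : ℝ)⁻¹ * (κw + 1) ^ 0 * Real.exp (1 * κ₁t)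
      = ε₂w * α₆w / 2 * (Real.exp (-κ₁t) * Real.exp (1 * κ₁t)) := by rw [pow_zero, inv_one]; ring
    _ = ε₂w * α₆w / 2 := by rw [hexp, mul_one]
    _ ≤ 1 * 1 / 2 := by gcongr
    _ = 1 / 2 := by norm_num

/-! ## §2 ★ Every non-owner binder of J89, jointly -/

variable (F : T4Family) {𝔸 : Type} [NormedRing 𝔸] [NormedAlgebra ℂ 𝔸]

open Classical in
/-- ★ **THE POSITIVE A2 CERTIFICATE OF THE ROAD-2 SOCKET OF RECORD J89**: for every parameter tower `F`, sizes `M, L` (the `hLc` conjunct below is the `L`-free `consts.L = 8`; §3 has `consts.L = L` verbatim), table system `sp`, window `γ`, N18 letters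
`0 < θ₅ < 1`, `0 < κ₅`, `C₅`, chart letters `B₃, r`, every renewal size `E₀ ≥ e·9·64·K₀(64,8)²·C₃ε₁` and every decay rate `2κ₀(64,8) + 1 ≤ r₁ ≤ consts.κ − 1`, there exist
`ℓ` (`ℓ.θ₅ = θ₅`, `ℓ.Signs`), reals `a κ κE δ₀ R ϱ Mb cw cS cA Mv Bq b`, weights `aw`, coupling sets `D`, a term-data family `𝔇` over `consts` with readings `χᵘ χᶜᵘ 𝒲 𝒪` such that
J89's binders `hL hLc hκ₁ hα₆ hN hκ₀ hδ₀ hκE hκE0 hE₀ hA0 hr₁ hrate hKP hκr hrenew hrenewE hawcw hC1 hMb0 hϱ hR hcS hcSA hcA1 hρb hBq hsmall2 hMv hBqv hρb1 hb hbaw hκ₅ hω hθω hℓκ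
hC₉ hD hlaw hBox hχ1 hWm hιc` ALL hold (bodies VERBATIM at `c := consts`, `ρ_b := 1∕100`, `a₅ := ½`, `a₂ = a₂′ = Aabs := 1`, `θ.γ := γ`).  A2 bookkeeping at degenerate data and
the witness constants; nothing of Bałaban's; N22 NOT discharged.
[cite: Balaban1988RG2Cluster, p.21 (closing paragraph: "The assumptions allow finally us to fix all the constants"), (2.16)–(2.26) pp.16–17 (the located letters; bookkeeping)] -/
theorem socketNonOwnerBinders_inhabited (M L : ℕ) [NeZero M] [NeZero L] (sp : (K j : ℕ) → (domSys (F.P K) M j).Dom → Set (CPair (F.P K) 𝔸))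
    (γ : ℝ) {θ₅ κ₅ : ℝ} (C₅ B₃ r : ℝ) {E₀ r₁ : ℝ} (hθ₅ : 0 < θ₅) (hθ₅1 : θ₅ < 1) (hκ₅ : 0 < κ₅)
    (hE₀ : Real.exp 1 * 9 * 64 * K₀ 64 8 ^ 2 * (consts.C3act * consts.ε₁) ≤ E₀)
    (hr₁ : 2 * kappa₀ (4 * 2 ^ 4) (2 * 4) + 1 ≤ r₁) (hr₁' : r₁ ≤ consts.κ - 1) :
    ∃ (ℓ : U3Letters₁₁) (a κ κE δ₀ R ϱ Mb cw cS cA Mv Bq b : ℝ) (aw : ℕ → ℕ → ℕ → ℝ) (D : ℕ → Set ℂ)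
      (𝔇 : (K : ℕ) → TermData214 consts (F.P K) 𝔸 M L) (χu χcu : (K k : ℕ) → (𝔇 K k).UnscaledChi) (𝒲 : (K k : ℕ) → (𝔇 K k).UnscaledWilson)
      (𝒪 : (K k : ℕ) → (𝔇 K k).UnscaledOlder),
      -- the bill's letter record carries N18's rate and the displayed signs
      ℓ.θ₅ = θ₅ ∧ ℓ.Signs ∧
      -- hL hLc hκ₁ hα₆ hN : the numerics record of record
      8 ≤ consts.L ∧ consts.L = 8 ∧ 1 ≤ consts.κ₁ ∧ consts.α₆ ≠ 0 ∧ Lemma3Numerics consts M ((consts.L : ℝ) / 2) a 1 1 (1 / 2) 1 ∧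
      -- hκ₀ hδ₀ hκE hκE0 hE₀
      kappa₀ (4 * 2 ^ 4) (2 * 4) ≤ κ / 2 ∧ 0 < δ₀ ∧ κ ≤ κE ∧ 0 ≤ κE ∧ 0 ≤ E₀ ∧
      -- hA0 hr₁ hrate hKP hκr hrenew hrenewE hawcw hC1 hMb0 hϱ hR
      0 ≤ consts.C3act * consts.ε₁ ∧ 0 ≤ r₁ ∧ r₁ + 2 * (64 * Real.log 162) + 2 ≤ (1 - 8 * consts.δ) * ((consts.L : ℝ) / 2) * consts.κ ∧
      consts.C3act * consts.ε₁ * Real.exp (5 * r₁ + 1) * K₀ 64 8 * 9 * 64 < 1 ∧ κE ≤ r₁ ∧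
      Real.exp 1 * 9 * 64 * K₀ 64 8 ^ 2 * (consts.C3act * consts.ε₁) ≤ Mb ∧ Real.exp 1 * 9 * 64 * K₀ 64 8 ^ 2 * (consts.C3act * consts.ε₁) ≤ E₀ ∧
      (∀ K k j : ℕ, aw K k j ≤ cw) ∧ 4 * Mb * cw / ϱ < 1 ∧ 0 ≤ Mb ∧ 0 < ϱ ∧ cw * E₀ + ϱ < R ∧
      -- hcS hcSA hcA1 hρb hBq hsmall2 hMv hBqv hρb1 (ρ_b = 1∕100)
      0 < cS ∧ cS < cA ∧ cA < 1 ∧ cA / (1 - cA) < (1 / 100 : ℝ) ∧ 0 ≤ Bq ∧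
      2 * (consts.C3act * consts.ε₁) * Real.exp (5 * r₁ + 1) * K₀ 64 8 * 9 * 64 ≤ 1 ∧ 0 ≤ Mv ∧
      2 * (Real.exp 1 * 9 * 64 * K₀ 64 8 ^ 2 * (2 * (consts.C3act * consts.ε₁))) * ((1 - cA)⁻¹ ^ 2 * Mv) * (1 + cS) ^ 2 ≤ Bq ∧ (1 / 100 : ℝ) < 1 ∧
      -- hb hbaw
      0 < b ∧ (∀ K k j : ℕ, b ≤ aw K k j) ∧
      -- hκ₅ hω hθω hℓκ hC₉ (θ.γ := γ)
      delta1 δ₀ κ ((M : ℝ) * 4) ≤ κ₅ ∧ 0 < ℓ.ω ∧ ℓ.θ₅ ≤ ℓ.ω ^ 2 ∧ ℓ.κ ≤ delta1 δ₀ κ ((M : ℝ) * 4) ∧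
      (4 * (2 * C₅ / (1 - ℓ.θ₅) + 2 * ((16 * Mb * B₃ ^ 2 / r ^ 2) * Real.exp (delta1 δ₀ κ ((M : ℝ) * 4) * ((M : ℝ) * 4) * 3) * K₀ (4 * 2 ^ 4) (2 * 4) * K₁ 4 (δ₀ / 2))) / γ +
        ((16 * max ((6 * cS ^ 2 + 32 * cS + 64) / cS ^ 2 * Bq) (64 * Mb * cw ^ 2 / ϱ ^ 2 * (Bq * γ / cS) ^ 2 / (1 - 4 * Mb * cw / ϱ)) * B₃ ^ 2 / r ^ 2) *
          Real.exp (delta1 δ₀ κ ((M : ℝ) * 4) * ((M : ℝ) * 4) * 3) * K₀ (4 * 2 ^ 4) (2 * 4) * K₁ 4 (δ₀ / 2)) * γ / 2) / ℓ.ω ≤ ℓ.C₉ ∧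
      -- hD
      (∀ K : ℕ, ∀ t ∈ Ioc (0 : ℝ) γ, ((t : ℝ) : ℂ) ∈ D K) ∧
      -- hlaw hBox hχ1 hWm hιc (module J88-W′ §2)
      (∀ K, (𝔇 K).UnscaledFieldLawOn (χu K) (χcu K) (𝒲 K) (𝒪 K) γ) ∧
      (∀ (K k : ℕ) (Z : (domSys (F.P K) M (k + 1)).Dom) (s : TermLabel (F.P K) M k L), (𝔇 K k).UnscaledBoxLaws (χu K k) (χcu K k) Z s) ∧
      (∀ (K k : ℕ) (Z : (domSys (F.P K) M (k + 1)).Dom) (s : TermLabel (F.P K) M k L) (A : ((𝔇 K k).𝒦 Z s).Λ → ℝ), χu K k Z s A * χcu K k Z s A ≤ 1) ∧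
      (∀ (K k : ℕ) (Z : (domSys (F.P K) M (k + 1)).Dom) (t : TermLabel (F.P K) M k L) (φ : CPair (F.P K) 𝔸) (Y : TDom (F.P K).d (L * domCount (F.P K) M (k + 1))),
        Measurable fun B : ((𝔇 K k).𝒦 Z t).Λ → ℝ => 𝒲 K k Z t φ Y B) ∧
      (∀ (K k : ℕ) (old : OlderTerms (F.P K) 𝔸 M k), old ∈ AdmHist (sp K) E₀ r₁ k ∧ old 0 = 0 → ∀ (X : (domSys (F.P K) M (k + 1)).Dom), ∀ φ ∈ sp K (k + 1) X,
      ∀ Z : (domSys (F.P K) M (k + 1)).Dom, Subtype.val Z ⊆ Subtype.val X → ∀ s ∈ terms L M Z, ∀ t ∈ Ioc (0 : ℝ) γ,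
        ∃ ι : (𝔇 K k).Inputs226Holo consts Z s ((t : ℝ) : ℂ) old φ a (1 / 2), ∃ ag : (𝔇 K k).AnalyticGrowthInputs (χu K k) (𝒲 K k) (𝒪 K k) Z s old φ ι.Uτ,
        ∃ KE KG' KCs' θΓ' θC' θE' am wm δ : ℝ,
          0 ≤ KE ∧
          (∀ b b', ‖(((𝔇 K k).𝒦 Z s).C⁻¹.map (algebraMap ℝ ℂ)) b b'‖ ≤
            KE * Real.exp (-(ι.kap * tdist1 (𝔇 K k).Nf (((𝔇 K k).𝒦 Z s).locΛ b) (((𝔇 K k).𝒦 Z s).locΛ b')))) ∧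
          (1 + (1 / 100 : ℝ)) * ι.KG ≤ KG' ∧ ((1 - (1 / 100 : ℝ)) ^ 2)⁻¹ * ι.KCs ≤ KCs' ∧ ι.θΓ + (1 / 100 : ℝ) * ι.KG ≤ θΓ' ∧
          ι.θC + (1 / 100 : ℝ) * (2 + (1 / 100 : ℝ)) * ((1 - (1 / 100 : ℝ)) ^ 2)⁻¹ * ι.KCs ≤ θC' ∧ ι.θE + (1 / 100 : ℝ) * (2 + (1 / 100 : ℝ)) * (ι.θE + KE) ≤ θE' ∧ θE' ≤ ι.θ ∧ θΓ' ≤ ι.θ ∧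
          ((((𝔇 K k).𝒦 Z s).m * (1 + 2 / (ι.kap - ι.kap')) ^ (𝔇 K k).ν) * (((𝔇 K k).𝒦 Z s).m * (1 + 2 / (ι.kap' - ι.kap'')) ^ (𝔇 K k).ν)
            * (θΓ' * KCs' * KG' + ι.KΓ * θC' * KG' + ι.KΓ * ι.K₀ * θΓ') ≤ ι.θ) ∧
          (1 + (1 / 100 : ℝ)) ^ 2 * (2 * ag.ρ * (ag.Cp * K₀ (4 * 2 ^ (F.P K).d) (2 * (F.P K).d))) ≤ am ∧ (1 + (1 / 100 : ℝ)) ^ 2 * (∑ Y ∈ s.1, ag.Rτ Y * (ag.M𝒪 Y + (2 * ag.M𝒪 Y / ag.R) * ag.ρ)) ≤ wm ∧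
          0 < δ ∧ 2 * δ + 8 * ag.ρ * (ag.Cp * K₀ (4 * 2 ^ (F.P K).d) (2 * (F.P K).d)) ≤ am ∧
          Real.exp (∑ Y ∈ s.1, ag.Rτ Y * ag.M𝒪 Y)
              * ((∑ Y ∈ s.1, ag.Rτ Y * ((4 * (2 * ag.M𝒲 Y / ag.R ^ 4) + (4 * (ag.M𝒲 Y / ag.R ^ 3) + 4 * (ag.M𝒲 Y / ag.R ^ 3)) / ag.ρ) * (4 / (Real.exp 1 * δ)) ^ 4
                    + ((4 * ag.M𝒪 Y / ag.R ^ 2) + ((2 * ag.M𝒪 Y / ag.R) + (2 * ag.M𝒪 Y / ag.R)) / ag.ρ) * (2 / (Real.exp 1 * δ)) ^ 2)) * Real.exp (δ / 2)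
                 + ((∑ Y ∈ s.1, ag.Rτ Y * (4 * (ag.M𝒲 Y / ag.R ^ 3) * (3 / (Real.exp 1 * δ)) ^ 3 + (2 * ag.M𝒪 Y / ag.R) * (1 / (Real.exp 1 * δ))))
                      * Real.exp (δ / 2)) ^ 2
                    * Real.exp ((∑ Y ∈ s.1, ag.Rτ Y * (ag.M𝒪 Y + (2 * ag.M𝒪 Y / ag.R) * ag.ρ)) + ∑ Y ∈ s.1, ag.Rτ Y * ag.M𝒪 Y))
              ≤ Real.exp wm ∧
          (2 * (ι.θ * (((𝔇 K k).𝒦 Z s).m * (1 + 2 / ι.kap'') ^ (𝔇 K k).ν)) + (ι.γ₂ + am)) * ι.cE ≤ 1 / 2 ∧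
          (2 * (ι.θ * (((𝔇 K k).𝒦 Z s).m * (1 + 2 / ι.kap'') ^ (𝔇 K k).ν)) + (ι.γ₂ + am)) * (1 + 2 * ι.cE * ι.g) ≤ 1 / 2 ∧
          2 * (ι.K₀ * (((𝔇 K k).𝒦 Z s).m * (1 + 2 / ι.kap) ^ (𝔇 K k).ν) * (ι.θ * (((𝔇 K k).𝒦 Z s).m * (1 + 2 / ι.kap'') ^ (𝔇 K k).ν))
              * (1 + (1 - ι.K₀ * (((𝔇 K k).𝒦 Z s).m * (1 + 2 / ι.kap) ^ (𝔇 K k).ν) * (ι.θ * (((𝔇 K k).𝒦 Z s).m * (1 + 2 / ι.kap'') ^ (𝔇 K k).ν)))⁻¹) / 2)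
              * (Fintype.card ((𝔇 K k).𝒦 Z s).Λ : ℝ)
            + wm + (2 * (ι.θ * (((𝔇 K k).𝒦 Z s).m * (1 + 2 / ι.kap'') ^ (𝔇 K k).ν)) + (ι.γ₂ + am)) * ι.cE * (Fintype.card ((𝔇 K k).𝒦 Z s).Λ : ℝ)
            + (2 * (ι.θ * (((𝔇 K k).𝒦 Z s).m * (1 + 2 / ι.kap'') ^ (𝔇 K k).ν)) + (ι.γ₂ + am)) * (1 + 2 * ι.cE * ι.g)
              * (Fintype.card (((𝔇 K k).𝒦 Z s).Λ ⊕ ((𝔇 K k).𝒦 Z s).C₀) : ℝ)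
            ≤ 1 / 2 * ((Z.1).card : ℝ) ∧
          (s.2.card = 0 → ∃ κb Rb T : ℝ, 0 ≤ κb ∧ κb ≤ ι.γ₂ + am ∧
            (∀ B : ((𝔇 K k).𝒦 Z s).Λ → ℝ, B ⬝ᵥ B < Rb ^ 2 → χu K k Z s (t • B) * χcu K k Z s (t • B) = 1) ∧
            Real.exp (-(κb / 2 * Rb ^ 2)) ≤ T * t ^ 2 ∧ 1 + T ≤ Mv) ∧
          (s.2.card ≠ 0 → ∃ r₁' T' : ℝ, r₁' ^ 2 ≤ ι.rP ^ 2 ∧ a ≤ ι.γ₂ * r₁' ^ 2 ∧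
            Real.exp (-(ι.γ₂ / 2 * (ι.rP ^ 2 - r₁' ^ 2))) ≤ T' * t ^ 2 ∧ T' ≤ Mv)) := by
  obtain ⟨c1, -, c3, c4, -, -, -, c8, -, -, -, -, -, -, -, -, -, -, -, -, -, -, -, -, -, -, -, -, c29, c30, c31, -, -, -, -, -, -, c38, -, c40, -⟩ :=
    numerics_nonvacuous_pos_consts
  -- W1-8's elementary conditions at `consts`, and the datum side (J88-W′ §2) at `a := aw + 40M`, `Mv := 2`
  have hEc : 0 < consts.E₀ := by linarith
  have hC₁ : 0 < consts.C₁ := by show (0 : ℝ) < 1; norm_num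
  have hα₄ : 0 < consts.α₄ := by show (0 : ℝ) < 1; norm_num
  have hMc : 0 < consts.M := by
    show (0 : ℝ) < κw + 1
    have : 0 ≤ κw := by unfold κw κ₀w; linarith [kappa₀_nonneg (by norm_num : (0 : ℝ) ≤ 64) 8]
    linarith
  have hδκ : 0 ≤ (1 - 3 * consts.δ) * consts.κ := mul_nonneg (by show (0 : ℝ) ≤ 1 - 3 * (3 / 40); norm_num) c8
  obtain ⟨𝔇, χu, χcu, 𝒲, 𝒪, hlaw, hBox, hχ1, hWm, hιc⟩ := socketFamilies_inhabited_lemma2_half F M L c40 hEc c3 hC₁ hα₄ hMc hδκ pref_consts sp E₀ r₁ γ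
    (B13Lemma3WindowNonvacuity.aw + 40 * (M : ℝ)) (Mv := 2) (by norm_num)
  -- the lane-side reals
  have eκ₀ : kappa₀ (4 * 2 ^ 4) (2 * 4) = kappa₀ 64 8 := by norm_num
  have hκ₀0 : 0 ≤ kappa₀ (4 * 2 ^ 4) (2 * 4) := by rw [eκ₀]; exact kappa₀_nonneg (by norm_num) 8
  set κ : ℝ := 2 * kappa₀ (4 * 2 ^ 4) (2 * 4) + 1 with hκdef
  have hκpos : 0 < κ := by rw [hκdef]; linarith
  set δ₀ : ℝ := min 1 κ₅ with hδ₀def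
  have hδ₀ : 0 < δ₀ := lt_min one_pos hκ₅
  have hM0 : (0 : ℝ) < (M : ℝ) := by exact_mod_cast Nat.pos_of_ne_zero (NeZero.ne M)
  have hM4 : (0 : ℝ) < (M : ℝ) * 4 := by positivity
  have hd1 : 0 ≤ delta1 δ₀ κ ((M : ℝ) * 4) := delta1_nonneg hδ₀.le hκpos.le hM4
  have hd1κ₅ : delta1 δ₀ κ ((M : ℝ) * 4) ≤ κ₅ := by
    have h1 := delta1_le_half δ₀ κ ((M : ℝ) * 4)
    have h2 : δ₀ ≤ κ₅ := min_le_right _ _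
    linarith
  set mstar : ℝ := Real.exp 1 * 9 * 64 * K₀ 64 8 ^ 2 * (consts.C3act * consts.ε₁) with hmdef
  have hm0 : 0 ≤ mstar := mul_nonneg (by positivity) c29
  set cw : ℝ := 1 / (8 * mstar + 8) with hcwdef
  have hcw0 : 0 < cw := by rw [hcwdef]; exact div_pos one_pos (by linarith)
  set ω : ℝ := (1 + θ₅) / 2 with hωdef
  have hω0 : 0 < ω := by rw [hωdef]; linarith
  have hω1 : ω < 1 := by rw [hωdef]; linarith
  have hθω : θ₅ ≤ ω ^ 2 := by rw [hωdef]; nlinarith [sq_nonneg (1 - θ₅)]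
  have hθρ : θ₅ ≤ ω := by rw [hωdef]; linarith
  have hBq0 : 0 ≤ 2 * (Real.exp 1 * 9 * 64 * K₀ 64 8 ^ 2 * (2 * (consts.C3act * consts.ε₁))) * ((1 - (1 / 200 : ℝ))⁻¹ ^ 2 * 2) * (1 + (1 / 400 : ℝ)) ^ 2 :=
    mul_nonneg (mul_nonneg (mul_nonneg (by norm_num) (mul_nonneg (by positivity) (mul_nonneg (by norm_num) c29))) (by norm_num)) (by positivity)
  -- hKP (strict, dag-n18-c) and hsmall2 (factor 2 against the slack e^{−5} at r₁ ≤ consts.κ − 1)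
  have hKP : consts.C3act * consts.ε₁ * Real.exp (5 * r₁ + 1) * K₀ 64 8 * 9 * 64 < 1 := strictKP_of_le_one_of_lt c29 c31 (by linarith)
  have hK : 0 ≤ K₀ 64 8 := (K₀_pos 64 8).le
  have hAK : 0 ≤ consts.C3act * consts.ε₁ * K₀ 64 8 * 9 * 64 := mul_nonneg (mul_nonneg (mul_nonneg c29 hK) (by norm_num)) (by norm_num)
  have hsmall2 : 2 * (consts.C3act * consts.ε₁) * Real.exp (5 * r₁ + 1) * K₀ 64 8 * 9 * 64 ≤ 1 := by
    have hexp : Real.exp (5 * r₁ + 1) ≤ Real.exp (-5) * Real.exp (5 * consts.κ + 1) := by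
      rw [← Real.exp_add]; exact Real.exp_le_exp.2 (by linarith)
    have he5 : Real.exp (-5) ≤ 1 / 2 := by
      have h2 : (2 : ℝ) ≤ Real.exp 5 := by linarith [Real.add_one_le_exp (5 : ℝ)]
      rw [Real.exp_neg, one_div]
      exact inv_anti₀ (by norm_num) h2
    have hT : consts.C3act * consts.ε₁ * Real.exp (5 * r₁ + 1) * K₀ 64 8 * 9 * 64 ≤
        Real.exp (-5) * (consts.C3act * consts.ε₁ * Real.exp (5 * consts.κ + 1) * K₀ 64 8 * 9 * 64) := by
      have h1 : consts.C3act * consts.ε₁ * Real.exp (5 * r₁ + 1) * K₀ 64 8 * 9 * 64 =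
          (consts.C3act * consts.ε₁ * K₀ 64 8 * 9 * 64) * Real.exp (5 * r₁ + 1) := by ring
      have h2 : Real.exp (-5) * (consts.C3act * consts.ε₁ * Real.exp (5 * consts.κ + 1) * K₀ 64 8 * 9 * 64) =
          (consts.C3act * consts.ε₁ * K₀ 64 8 * 9 * 64) * (Real.exp (-5) * Real.exp (5 * consts.κ + 1)) := by ring
      rw [h1, h2]
      exact mul_le_mul_of_nonneg_left hexp hAK
    have hP : 0 ≤ consts.C3act * consts.ε₁ * Real.exp (5 * consts.κ + 1) * K₀ 64 8 * 9 * 64 :=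
      mul_nonneg (mul_nonneg (mul_nonneg (mul_nonneg c29 (Real.exp_pos _).le) hK) (by norm_num)) (by norm_num)
    have h3 : Real.exp (-5) * (consts.C3act * consts.ε₁ * Real.exp (5 * consts.κ + 1) * K₀ 64 8 * 9 * 64) ≤ 1 / 2 * 1 :=
      mul_le_mul he5 c31 hP (by norm_num)
    calc 2 * (consts.C3act * consts.ε₁) * Real.exp (5 * r₁ + 1) * K₀ 64 8 * 9 * 64
        = 2 * (consts.C3act * consts.ε₁ * Real.exp (5 * r₁ + 1) * K₀ 64 8 * 9 * 64) := by ring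
      _ ≤ 2 * (1 / 2 * 1) := by linarith
      _ = 1 := by norm_num
  -- hC1, hrate, hκ₀, signs
  have hC1 : 4 * mstar * cw / 1 < 1 := by
    rw [div_one, hcwdef, mul_one_div, div_lt_one (by linarith)]
    linarith
  have hrate : r₁ + 2 * (64 * Real.log 162) + 2 ≤ (1 - 8 * consts.δ) * ((consts.L : ℝ) / 2) * consts.κ := by linarith
  have hr₁0 : 0 ≤ r₁ := by linarith
  have hκ₀ : kappa₀ (4 * 2 ^ 4) (2 * 4) ≤ κ / 2 := by rw [hκdef]; linarith
  -- the bill's letter record: `C₉ := max 0 (hC₉'s left side)`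
  set Bq : ℝ := 2 * (Real.exp 1 * 9 * 64 * K₀ 64 8 ^ 2 * (2 * (consts.C3act * consts.ε₁))) * ((1 - (1 / 200 : ℝ))⁻¹ ^ 2 * (2 : ℝ)) *
    (1 + (1 / 400 : ℝ)) ^ 2 with hBqdef
  have hBq0 : 0 ≤ Bq := by
    rw [hBqdef]
    exact mul_nonneg (mul_nonneg (mul_nonneg (by norm_num) (mul_nonneg (by positivity) (mul_nonneg (by norm_num) c29))) (by norm_num))
      (by positivity)
  set X : ℝ := (4 * (2 * C₅ / (1 - θ₅) + 2 * ((16 * mstar * B₃ ^ 2 / r ^ 2) *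
      Real.exp (delta1 δ₀ κ ((M : ℝ) * 4) * ((M : ℝ) * 4) * 3) * K₀ (4 * 2 ^ 4) (2 * 4) * K₁ 4 (δ₀ / 2))) / γ +
      ((16 * max ((6 * (1 / 400 : ℝ) ^ 2 + 32 * (1 / 400 : ℝ) + 64) / (1 / 400 : ℝ) ^ 2 * Bq)
        (64 * mstar * cw ^ 2 / (1 : ℝ) ^ 2 * (Bq * γ / (1 / 400 : ℝ)) ^ 2 / (1 - 4 * mstar * cw / (1 : ℝ))) * B₃ ^ 2 / r ^ 2) *
        Real.exp (delta1 δ₀ κ ((M : ℝ) * 4) * ((M : ℝ) * 4) * 3) * K₀ (4 * 2 ^ 4) (2 * 4) * K₁ 4 (δ₀ / 2)) * γ / 2) / ω with hXdef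
  let ℓ : U3Letters₁₁ := ⟨delta1 δ₀ κ ((M : ℝ) * 4), θ₅, 0, max 0 X, ω, 0, ω⟩
  have hℓθ : ℓ.θ₅ = θ₅ := rfl
  have hℓω : ℓ.ω = ω := rfl
  have hℓκ : ℓ.κ = delta1 δ₀ κ ((M : ℝ) * 4) := rfl
  have hℓC : ℓ.C₉ = max 0 X := rfl
  have hsigns : ℓ.Signs := ⟨hd1, hθ₅, hθ₅1, le_rfl, le_max_left _ _, hω0.le, hω1, le_rfl, hθρ, le_rfl, hω1⟩
  have hC₉ : (4 * (2 * C₅ / (1 - ℓ.θ₅) + 2 * ((16 * mstar * B₃ ^ 2 / r ^ 2) *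
      Real.exp (delta1 δ₀ κ ((M : ℝ) * 4) * ((M : ℝ) * 4) * 3) * K₀ (4 * 2 ^ 4) (2 * 4) * K₁ 4 (δ₀ / 2))) / γ +
      ((16 * max ((6 * (1 / 400 : ℝ) ^ 2 + 32 * (1 / 400 : ℝ) + 64) / (1 / 400 : ℝ) ^ 2 * Bq)
        (64 * mstar * cw ^ 2 / (1 : ℝ) ^ 2 * (Bq * γ / (1 / 400 : ℝ)) ^ 2 / (1 - 4 * mstar * cw / (1 : ℝ))) * B₃ ^ 2 / r ^ 2) *
        Real.exp (delta1 δ₀ κ ((M : ℝ) * 4) * ((M : ℝ) * 4) * 3) * K₀ (4 * 2 ^ 4) (2 * 4) * K₁ 4 (δ₀ / 2)) * γ / 2) / ℓ.ω ≤ ℓ.C₉ := by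
    rw [hℓθ, hℓω, hℓC, ← hXdef]; exact le_max_right _ _
  refine ⟨ℓ, B13Lemma3WindowNonvacuity.aw + 40 * (M : ℝ), κ, κ, δ₀, cw * E₀ + 2, 1, mstar, cw, 1 / 400, 1 / 200, 2, Bq, cw,
    fun _ _ _ => cw, fun _ => univ, 𝔇, χu, χcu, 𝒲, 𝒪, ?_⟩
  refine ⟨hℓθ, hsigns, c1, consts_L, c40, c4.ne', lemma3Numerics_consts_anyM M, hκ₀, hδ₀, le_rfl, hκpos.le, hm0.trans hE₀, ?_⟩
  refine ⟨c29, hr₁0, hrate, hKP, hr₁, le_rfl, hE₀, fun _ _ _ => le_rfl, hC1, hm0, one_pos, by linarith, ?_⟩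
  refine ⟨by norm_num, by norm_num, by norm_num, by norm_num, hBq0, hsmall2, by norm_num, ?_, by norm_num, ?_⟩
  · -- hBqv
    rw [hBqdef]
  refine ⟨hcw0, fun _ _ _ => le_rfl, hd1κ₅, ?_, ?_, ?_, hC₉, fun _ _ _ => mem_univ _, hlaw, hBox, hχ1, hWm, hιc⟩
  · rw [hℓω]; exact hω0
  · rw [hℓθ, hℓω]; exact hθω
  · rw [hℓκ]

/-! ## §3 (v1.1) ★ The same at the block size of the record — J89's `hLc : c.L = L` VERBATIM (referee ref-F READ-795 NIT-1) -/

open Classical in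
/-- ★ **(v1.1) THE POSITIVE A2 CERTIFICATE WITH `hLc` VERBATIM** — §2 stated J89's `hLc : c.L = L` as the `L`-free `consts.L = 8`; at `c := consts` the socket admits ONLY the block
size `L = consts.L = 8`, so here `hLc : consts.L = L` is taken as the (universal) hypothesis it is in J89 and returned as the conjunct `consts.L = L`: for every `L` WITH `consts.L = L`
(i.e. `L = 8`) and every `F M sp γ θ₅ κ₅ C₅ B₃ r E₀ r₁` as in §2, ALL 44 non-owner binders of J89 hold at once with bodies verbatim (`c := consts`, `ρ_b := 1∕100`, `a₅ := ½`,
`a₂ = a₂′ = Aabs := 1`, `θ.γ := γ`) — §2 repackaged, one line.  A2 bookkeeping; nothing of Bałaban's; N22 NOT discharged.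
[cite: Balaban1988RG2Cluster, p.21 (closing paragraph: "The assumptions allow finally us to fix all the constants")] -/
theorem socketNonOwnerBinders_inhabited_atBlockSize (M L : ℕ) [NeZero M] [NeZero L] (hLc : consts.L = L) (sp : (K j : ℕ) → (domSys (F.P K) M j).Dom → Set (CPair (F.P K) 𝔸))
    (γ : ℝ) {θ₅ κ₅ : ℝ} (C₅ B₃ r : ℝ) {E₀ r₁ : ℝ} (hθ₅ : 0 < θ₅) (hθ₅1 : θ₅ < 1) (hκ₅ : 0 < κ₅)
    (hE₀ : Real.exp 1 * 9 * 64 * K₀ 64 8 ^ 2 * (consts.C3act * consts.ε₁) ≤ E₀)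
    (hr₁ : 2 * kappa₀ (4 * 2 ^ 4) (2 * 4) + 1 ≤ r₁) (hr₁' : r₁ ≤ consts.κ - 1) :
    ∃ (ℓ : U3Letters₁₁) (a κ κE δ₀ R ϱ Mb cw cS cA Mv Bq b : ℝ) (aw : ℕ → ℕ → ℕ → ℝ) (D : ℕ → Set ℂ)
      (𝔇 : (K : ℕ) → TermData214 consts (F.P K) 𝔸 M L) (χu χcu : (K k : ℕ) → (𝔇 K k).UnscaledChi) (𝒲 : (K k : ℕ) → (𝔇 K k).UnscaledWilson)
      (𝒪 : (K k : ℕ) → (𝔇 K k).UnscaledOlder),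
      -- the bill's letter record carries N18's rate and the displayed signs
      ℓ.θ₅ = θ₅ ∧ ℓ.Signs ∧
      -- hL hLc hκ₁ hα₆ hN : the numerics record of record (`hLc` VERBATIM: `consts.L = L`)
      8 ≤ consts.L ∧ consts.L = L ∧ 1 ≤ consts.κ₁ ∧ consts.α₆ ≠ 0 ∧ Lemma3Numerics consts M ((consts.L : ℝ) / 2) a 1 1 (1 / 2) 1 ∧
      -- hκ₀ hδ₀ hκE hκE0 hE₀
      kappa₀ (4 * 2 ^ 4) (2 * 4) ≤ κ / 2 ∧ 0 < δ₀ ∧ κ ≤ κE ∧ 0 ≤ κE ∧ 0 ≤ E₀ ∧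
      -- hA0 hr₁ hrate hKP hκr hrenew hrenewE hawcw hC1 hMb0 hϱ hR
      0 ≤ consts.C3act * consts.ε₁ ∧ 0 ≤ r₁ ∧ r₁ + 2 * (64 * Real.log 162) + 2 ≤ (1 - 8 * consts.δ) * ((consts.L : ℝ) / 2) * consts.κ ∧
      consts.C3act * consts.ε₁ * Real.exp (5 * r₁ + 1) * K₀ 64 8 * 9 * 64 < 1 ∧ κE ≤ r₁ ∧
      Real.exp 1 * 9 * 64 * K₀ 64 8 ^ 2 * (consts.C3act * consts.ε₁) ≤ Mb ∧ Real.exp 1 * 9 * 64 * K₀ 64 8 ^ 2 * (consts.C3act * consts.ε₁) ≤ E₀ ∧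
      (∀ K k j : ℕ, aw K k j ≤ cw) ∧ 4 * Mb * cw / ϱ < 1 ∧ 0 ≤ Mb ∧ 0 < ϱ ∧ cw * E₀ + ϱ < R ∧
      -- hcS hcSA hcA1 hρb hBq hsmall2 hMv hBqv hρb1 (ρ_b = 1∕100)
      0 < cS ∧ cS < cA ∧ cA < 1 ∧ cA / (1 - cA) < (1 / 100 : ℝ) ∧ 0 ≤ Bq ∧
      2 * (consts.C3act * consts.ε₁) * Real.exp (5 * r₁ + 1) * K₀ 64 8 * 9 * 64 ≤ 1 ∧ 0 ≤ Mv ∧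
      2 * (Real.exp 1 * 9 * 64 * K₀ 64 8 ^ 2 * (2 * (consts.C3act * consts.ε₁))) * ((1 - cA)⁻¹ ^ 2 * Mv) * (1 + cS) ^ 2 ≤ Bq ∧ (1 / 100 : ℝ) < 1 ∧
      -- hb hbaw
      0 < b ∧ (∀ K k j : ℕ, b ≤ aw K k j) ∧
      -- hκ₅ hω hθω hℓκ hC₉ (θ.γ := γ)
      delta1 δ₀ κ ((M : ℝ) * 4) ≤ κ₅ ∧ 0 < ℓ.ω ∧ ℓ.θ₅ ≤ ℓ.ω ^ 2 ∧ ℓ.κ ≤ delta1 δ₀ κ ((M : ℝ) * 4) ∧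
      (4 * (2 * C₅ / (1 - ℓ.θ₅) + 2 * ((16 * Mb * B₃ ^ 2 / r ^ 2) * Real.exp (delta1 δ₀ κ ((M : ℝ) * 4) * ((M : ℝ) * 4) * 3) * K₀ (4 * 2 ^ 4) (2 * 4) * K₁ 4 (δ₀ / 2))) / γ +
        ((16 * max ((6 * cS ^ 2 + 32 * cS + 64) / cS ^ 2 * Bq) (64 * Mb * cw ^ 2 / ϱ ^ 2 * (Bq * γ / cS) ^ 2 / (1 - 4 * Mb * cw / ϱ)) * B₃ ^ 2 / r ^ 2) *
          Real.exp (delta1 δ₀ κ ((M : ℝ) * 4) * ((M : ℝ) * 4) * 3) * K₀ (4 * 2 ^ 4) (2 * 4) * K₁ 4 (δ₀ / 2)) * γ / 2) / ℓ.ω ≤ ℓ.C₉ ∧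
      -- hD
      (∀ K : ℕ, ∀ t ∈ Ioc (0 : ℝ) γ, ((t : ℝ) : ℂ) ∈ D K) ∧
      -- hlaw hBox hχ1 hWm hιc (module J88-W′ §2)
      (∀ K, (𝔇 K).UnscaledFieldLawOn (χu K) (χcu K) (𝒲 K) (𝒪 K) γ) ∧
      (∀ (K k : ℕ) (Z : (domSys (F.P K) M (k + 1)).Dom) (s : TermLabel (F.P K) M k L), (𝔇 K k).UnscaledBoxLaws (χu K k) (χcu K k) Z s) ∧
      (∀ (K k : ℕ) (Z : (domSys (F.P K) M (k + 1)).Dom) (s : TermLabel (F.P K) M k L) (A : ((𝔇 K k).𝒦 Z s).Λ → ℝ), χu K k Z s A * χcu K k Z s A ≤ 1) ∧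
      (∀ (K k : ℕ) (Z : (domSys (F.P K) M (k + 1)).Dom) (t : TermLabel (F.P K) M k L) (φ : CPair (F.P K) 𝔸) (Y : TDom (F.P K).d (L * domCount (F.P K) M (k + 1))),
        Measurable fun B : ((𝔇 K k).𝒦 Z t).Λ → ℝ => 𝒲 K k Z t φ Y B) ∧
      (∀ (K k : ℕ) (old : OlderTerms (F.P K) 𝔸 M k), old ∈ AdmHist (sp K) E₀ r₁ k ∧ old 0 = 0 → ∀ (X : (domSys (F.P K) M (k + 1)).Dom), ∀ φ ∈ sp K (k + 1) X,
      ∀ Z : (domSys (F.P K) M (k + 1)).Dom, Subtype.val Z ⊆ Subtype.val X → ∀ s ∈ terms L M Z, ∀ t ∈ Ioc (0 : ℝ) γ,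
        ∃ ι : (𝔇 K k).Inputs226Holo consts Z s ((t : ℝ) : ℂ) old φ a (1 / 2), ∃ ag : (𝔇 K k).AnalyticGrowthInputs (χu K k) (𝒲 K k) (𝒪 K k) Z s old φ ι.Uτ,
        ∃ KE KG' KCs' θΓ' θC' θE' am wm δ : ℝ,
          0 ≤ KE ∧
          (∀ b b', ‖(((𝔇 K k).𝒦 Z s).C⁻¹.map (algebraMap ℝ ℂ)) b b'‖ ≤
            KE * Real.exp (-(ι.kap * tdist1 (𝔇 K k).Nf (((𝔇 K k).𝒦 Z s).locΛ b) (((𝔇 K k).𝒦 Z s).locΛ b')))) ∧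
          (1 + (1 / 100 : ℝ)) * ι.KG ≤ KG' ∧ ((1 - (1 / 100 : ℝ)) ^ 2)⁻¹ * ι.KCs ≤ KCs' ∧ ι.θΓ + (1 / 100 : ℝ) * ι.KG ≤ θΓ' ∧
          ι.θC + (1 / 100 : ℝ) * (2 + (1 / 100 : ℝ)) * ((1 - (1 / 100 : ℝ)) ^ 2)⁻¹ * ι.KCs ≤ θC' ∧ ι.θE + (1 / 100 : ℝ) * (2 + (1 / 100 : ℝ)) * (ι.θE + KE) ≤ θE' ∧ θE' ≤ ι.θ ∧ θΓ' ≤ ι.θ ∧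
          ((((𝔇 K k).𝒦 Z s).m * (1 + 2 / (ι.kap - ι.kap')) ^ (𝔇 K k).ν) * (((𝔇 K k).𝒦 Z s).m * (1 + 2 / (ι.kap' - ι.kap'')) ^ (𝔇 K k).ν)
            * (θΓ' * KCs' * KG' + ι.KΓ * θC' * KG' + ι.KΓ * ι.K₀ * θΓ') ≤ ι.θ) ∧
          (1 + (1 / 100 : ℝ)) ^ 2 * (2 * ag.ρ * (ag.Cp * K₀ (4 * 2 ^ (F.P K).d) (2 * (F.P K).d))) ≤ am ∧ (1 + (1 / 100 : ℝ)) ^ 2 * (∑ Y ∈ s.1, ag.Rτ Y * (ag.M𝒪 Y + (2 * ag.M𝒪 Y / ag.R) * ag.ρ)) ≤ wm ∧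
          0 < δ ∧ 2 * δ + 8 * ag.ρ * (ag.Cp * K₀ (4 * 2 ^ (F.P K).d) (2 * (F.P K).d)) ≤ am ∧
          Real.exp (∑ Y ∈ s.1, ag.Rτ Y * ag.M𝒪 Y)
              * ((∑ Y ∈ s.1, ag.Rτ Y * ((4 * (2 * ag.M𝒲 Y / ag.R ^ 4) + (4 * (ag.M𝒲 Y / ag.R ^ 3) + 4 * (ag.M𝒲 Y / ag.R ^ 3)) / ag.ρ) * (4 / (Real.exp 1 * δ)) ^ 4
                    + ((4 * ag.M𝒪 Y / ag.R ^ 2) + ((2 * ag.M𝒪 Y / ag.R) + (2 * ag.M𝒪 Y / ag.R)) / ag.ρ) * (2 / (Real.exp 1 * δ)) ^ 2)) * Real.exp (δ / 2)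
                 + ((∑ Y ∈ s.1, ag.Rτ Y * (4 * (ag.M𝒲 Y / ag.R ^ 3) * (3 / (Real.exp 1 * δ)) ^ 3 + (2 * ag.M𝒪 Y / ag.R) * (1 / (Real.exp 1 * δ))))
                      * Real.exp (δ / 2)) ^ 2
                    * Real.exp ((∑ Y ∈ s.1, ag.Rτ Y * (ag.M𝒪 Y + (2 * ag.M𝒪 Y / ag.R) * ag.ρ)) + ∑ Y ∈ s.1, ag.Rτ Y * ag.M𝒪 Y))
              ≤ Real.exp wm ∧
          (2 * (ι.θ * (((𝔇 K k).𝒦 Z s).m * (1 + 2 / ι.kap'') ^ (𝔇 K k).ν)) + (ι.γ₂ + am)) * ι.cE ≤ 1 / 2 ∧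
          (2 * (ι.θ * (((𝔇 K k).𝒦 Z s).m * (1 + 2 / ι.kap'') ^ (𝔇 K k).ν)) + (ι.γ₂ + am)) * (1 + 2 * ι.cE * ι.g) ≤ 1 / 2 ∧
          2 * (ι.K₀ * (((𝔇 K k).𝒦 Z s).m * (1 + 2 / ι.kap) ^ (𝔇 K k).ν) * (ι.θ * (((𝔇 K k).𝒦 Z s).m * (1 + 2 / ι.kap'') ^ (𝔇 K k).ν))
              * (1 + (1 - ι.K₀ * (((𝔇 K k).𝒦 Z s).m * (1 + 2 / ι.kap) ^ (𝔇 K k).ν) * (ι.θ * (((𝔇 K k).𝒦 Z s).m * (1 + 2 / ι.kap'') ^ (𝔇 K k).ν)))⁻¹) / 2)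
              * (Fintype.card ((𝔇 K k).𝒦 Z s).Λ : ℝ)
            + wm + (2 * (ι.θ * (((𝔇 K k).𝒦 Z s).m * (1 + 2 / ι.kap'') ^ (𝔇 K k).ν)) + (ι.γ₂ + am)) * ι.cE * (Fintype.card ((𝔇 K k).𝒦 Z s).Λ : ℝ)
            + (2 * (ι.θ * (((𝔇 K k).𝒦 Z s).m * (1 + 2 / ι.kap'') ^ (𝔇 K k).ν)) + (ι.γ₂ + am)) * (1 + 2 * ι.cE * ι.g)
              * (Fintype.card (((𝔇 K k).𝒦 Z s).Λ ⊕ ((𝔇 K k).𝒦 Z s).C₀) : ℝ)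
            ≤ 1 / 2 * ((Z.1).card : ℝ) ∧
          (s.2.card = 0 → ∃ κb Rb T : ℝ, 0 ≤ κb ∧ κb ≤ ι.γ₂ + am ∧
            (∀ B : ((𝔇 K k).𝒦 Z s).Λ → ℝ, B ⬝ᵥ B < Rb ^ 2 → χu K k Z s (t • B) * χcu K k Z s (t • B) = 1) ∧
            Real.exp (-(κb / 2 * Rb ^ 2)) ≤ T * t ^ 2 ∧ 1 + T ≤ Mv) ∧
          (s.2.card ≠ 0 → ∃ r₁' T' : ℝ, r₁' ^ 2 ≤ ι.rP ^ 2 ∧ a ≤ ι.γ₂ * r₁' ^ 2 ∧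
            Real.exp (-(ι.γ₂ / 2 * (ι.rP ^ 2 - r₁' ^ 2))) ≤ T' * t ^ 2 ∧ T' ≤ Mv)) := by
  obtain ⟨ℓ, a, κ, κE, δ₀, R, ϱ, Mb, cw, cS, cA, Mv, Bq, b, aw, D, 𝔇, χu, χcu, 𝒲, 𝒪, h1, h2, h3, -, hrest⟩ :=
    socketNonOwnerBinders_inhabited F M L sp γ C₅ B₃ r hθ₅ hθ₅1 hκ₅ hE₀ hr₁ hr₁'
  exact ⟨ℓ, a, κ, κE, δ₀, R, ϱ, Mb, cw, cS, cA, Mv, Bq, b, aw, D, 𝔇, χu, χcu, 𝒲, 𝒪, h1, h2, h3, hLc, hrest⟩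

end YMDAG.N22.KernelFading

end
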